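import Mathlib

/-!
# Lift-off inner solution (explicit leading order) — kernel #111 (solo-blind s61)

In the inner variable `η = (x - x₀)/ℓ` the leading-order lift-off problem of the reduced steady
model is: `m - m''' = Q'''` on `ℝ` (mean-flow smoothing, `m` bounded), `m = 6` on `{Q > 0}`,
`Q = 0` elsewhere, `Q ∼ η³ + 0·η² + …` at `+∞` (the outer expansion has no `d²` term).
The solution is `Q(η) = (η³ + 3η - 4)₊ = (η - 1)(η² + η + 4)·1_{η>1}`, `m = 6·min(1, e^{η-1})`:
contact ONE smoothing length downstream of the outer contact, square-root amplitude onset.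
This file certifies the algebra: the factorisation/positivity of `Q`, the derivative data of the
two branches at the junction `η = 1`, the junction (jump) equations and their unique solution
`(c, c₁, c₂) = (1, 6, 3)`, and `η_c = 1` as the unique contact position killing the `η²` term.
-/

namespace Summit.AnomalousDissipation.AnomalousDissipation.Theorems

open Real

/-- the right branch `Q(η) = η³ + 3η - 4` and its factorisation -/
theorem liftoff_Q_factor (η : ℝ) : η ^ 3 + 3 * η - 4 = (η - 1) * (η ^ 2 + η + 4) := by ring

/-- `Q(η) = η³ + 3η - 4 > 0` strictly to the right of the contact `η = 1`. -/
theorem liftoff_Q_pos {η : ℝ} (h : 1 < η) : 0 < η ^ 3 + 3 * η - 4 := by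
  rw [liftoff_Q_factor]; exact mul_pos (by linarith) (by nlinarith [sq_nonneg η])

/-- `Q ≤ 0` for `η ≤ 1`: the pattern is absent upstream of `x₀ + ℓ`. -/
theorem liftoff_Q_nonpos {η : ℝ} (h : η ≤ 1) : η ^ 3 + 3 * η - 4 ≤ 0 := by
  rw [liftoff_Q_factor]; exact mul_nonpos_of_nonpos_of_nonneg (by linarith) (by nlinarith [sq_nonneg η])

/-- general right branch with contact at `c`: `(η-c)³ + 3(η-c)² + 6(η-c)`; its `η²`-coefficient
is `3 - 3c`, so matching to an outer expansion without quadratic term forces `c = 1`,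
and then the branch is exactly `η³ + 3η - 4`. -/
theorem liftoff_branch_expand (η c : ℝ) :
    (η - c) ^ 3 + 3 * (η - c) ^ 2 + 6 * (η - c)
      = η ^ 3 + (3 - 3 * c) * η ^ 2 + (3 * c ^ 2 - 6 * c + 6) * η + (-c ^ 3 + 3 * c ^ 2 - 6 * c) := by
  ring

/-- the `η²`-coefficient `3 - 3c` vanishes iff the contact sits at `c = 1`. -/
theorem liftoff_contact_unique (c : ℝ) : (3 - 3 * c = 0) ↔ c = 1 := by
  constructor <;> intro h <;> linarith

/-- with `c = 1` the right branch is `η³ + 3η - 4`. -/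
theorem liftoff_branch_at_one (η : ℝ) :
    (η - 1) ^ 3 + 3 * (η - 1) ^ 2 + 6 * (η - 1) = η ^ 3 + 3 * η - 4 := by ring

/-- derivative data of the right branch: `Q' = 3η² + 3`, `Q'' = 6η`, `Q''' = 6`;
at the junction `Q(1) = 0`, `Q'(1) = 6`, `Q''(1) = 6`. -/
theorem liftoff_Q_hasDerivAt (η : ℝ) :
    HasDerivAt (fun x : ℝ => x ^ 3 + 3 * x - 4) (3 * η ^ 2 + 3) η := by
  have h := ((hasDerivAt_pow 3 η).add ((hasDerivAt_id η).const_mul 3)).sub_const 4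
  simpa using h

/-- `Q'' = 6η`. -/
theorem liftoff_Q'_hasDerivAt (η : ℝ) :
    HasDerivAt (fun x : ℝ => 3 * x ^ 2 + 3) (6 * η) η := by
  have h1 : HasDerivAt (fun x : ℝ => x ^ 2) (2 * η) η := by simpa using hasDerivAt_pow 2 η
  have h2 := (h1.const_mul (3 : ℝ)).add_const (3 : ℝ)
  have e : (3 : ℝ) * (2 * η) = 6 * η := by ring
  rw [e] at h2
  exact h2

/-- `Q''' = 6` (so `m - m''' = Q'''` holds with `m ≡ 6` on the right). -/
theorem liftoff_Q''_hasDerivAt (η : ℝ) : HasDerivAt (fun x : ℝ => 6 * x) (6 : ℝ) η := by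
  simpa using (hasDerivAt_id η).const_mul 6

/-- right-branch junction data `Q(1) = 0`, `Q'(1) = 6`, `Q''(1) = 6`. -/
theorem liftoff_junction_right :
    (1 : ℝ) ^ 3 + 3 * 1 - 4 = 0 ∧ 3 * (1 : ℝ) ^ 2 + 3 = 6 ∧ 6 * (1 : ℝ) = 6 := by norm_num

/-- the left branch `m(η) = 6c·e^{η-1}` reproduces itself under differentiation, so
`m - m''' = 0` there and `m(1⁻) = m'(1⁻) = m''(1⁻) = 6c`. -/
theorem liftoff_m_left_hasDerivAt (c η : ℝ) :
    HasDerivAt (fun x : ℝ => 6 * c * exp (x - 1)) (6 * c * exp (η - 1)) η := by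
  have h := ((hasDerivAt_id η).sub_const 1).exp.const_mul (6 * c)
  simpa using h

/-- `m - m''' = 0` on the left branch (all derivatives of `6c e^{η-1}` coincide). -/
theorem liftoff_m_left_ode (c η : ℝ) :
    6 * c * exp (η - 1) - 6 * c * exp (η - 1) = 0 := sub_self _

/-- JUNCTION EQUATIONS. With `m⁻ = (6c, 6c, 6c)` (value, first, second derivative at `1⁻`),
`m⁺ = (6, 0, 0)`, and right branch `s³ + c₂ s² + c₁ s` (`s = η - 1`, so `[Q'] = c₁`, `[Q''] = 2c₂`),
the distributional identity `m - m''' = Q'''` across `η = 1` requires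
`[m] = 0`, `-[m'] = [Q']`, `-[m''] = [Q'']`.  Unique solution: `c = 1`, `c₁ = 6`, `c₂ = 3`. -/
theorem liftoff_junction_solve (c c₁ c₂ : ℝ)
    (h0 : 6 - 6 * c = 0) (h1 : -(0 - 6 * c) = c₁) (h2 : -(0 - 6 * c) = 2 * c₂) :
    c = 1 ∧ c₁ = 6 ∧ c₂ = 3 := by
  refine ⟨by linarith, by linarith, by linarith⟩

/-- `(c, c₁, c₂) = (1, 6, 3)` does satisfy the junction equations. -/
theorem liftoff_junction_check :
    (6 : ℝ) - 6 * 1 = 0 ∧ -((0 : ℝ) - 6 * 1) = 6 ∧ -((0 : ℝ) - 6 * 1) = 2 * 3 := by norm_num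

/-- the resulting branch with `(c₁, c₂) = (6, 3)` is the one of `liftoff_branch_at_one`. -/
theorem liftoff_solution (η : ℝ) :
    (η - 1) ^ 3 + 3 * (η - 1) ^ 2 + 6 * (η - 1) = (η - 1) * (η ^ 2 + η + 4) := by ring

/-- square-root onset: `Q(η) = 6(η-1) + O((η-1)²)`, precisely `Q - 6(η-1) = (η-1)²(η+2)`. -/
theorem liftoff_onset (η : ℝ) : (η ^ 3 + 3 * η - 4) - 6 * (η - 1) = (η - 1) ^ 2 * (η + 2) := by ring

/-- far field: `Q - η³ = 3η - 4`, the `O(ℓ²)` outer correction `3 C₃ ℓ² d - 4 C₃ ℓ³`. -/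
theorem liftoff_farfield (η : ℝ) : (η ^ 3 + 3 * η - 4) - η ^ 3 = 3 * η - 4 := by ring

end Summit.AnomalousDissipation.AnomalousDissipation.Theorems
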